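import Summits.HodgeConjecture.CorCM.GaloisTwentyFourDegenerateModels
import Mathlib.GroupTheory.SpecificGroups.Quaternion
import HarnessLib

/-!
# `Gal(K/ℚ) ≅ Q₁₆ × C₅` is BAD: a simple DEGENERATE CM abelian 40-fold (row `Q_{2^k} × C_p`, shape Q× of the five shapes)

COR-CM (cell `pub-hodgecm2`), binder seat b04 (gen 39), count-neutral own lane «Galois-CM-type classification» (blanket
`CorCM/GaloisQuaternion*`, b04).  HC_CM is NOT proved here; an unconditional negative-side example.  KERNEL ONLY: theorems
(`decide` certificates); no definition, no named fact, no `sorry`.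

`Q₁₆ × C₅` (``Q₁₆ = QuaternionGroup 4``, complex conjugation the unique central involution `(a 4, 1)`; `K` = a Galois CM field with group `Q_{16}`
times a real cyclic field of degree `5`) has all its proper CM quotients GOOD (`Q_{16}`, gen 20), all its involutions central
and its Sylow `5`-subgroup normal, so none of the structural BAD criteria (monotonicity, skew sections) applies: an ARITHMETIC instance of
the shape Q× (`CorCM/GaloisOddPrimeShapes`), listed open in the seat's A7-JUNCTION since gen 32 (random sampling found nothing).  The
type below comes from the seat's exhaustive TWO-SHEET meet-in-the-middle (gen 39, `scratch-g39/q2n/mitm.c`: with `A = ⟨a⟩ × C_5 ≅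
ℤ/8 × ℤ/5` of index `2`, the odd blocks are `2 × 2` and a type `T = S₁ ⊔ x S₂` is degenerate iff
`Ŝ₁(χ)Ŝ₁(χ^x) + Ŝ₂(χ)Ŝ₂(χ^x) = 0` at `χ = (ζ_{8}, ζ_5)`); its annihilator is `±1` on `12` elements, i.e. a
balanced set `D` of `6` elements in gen 20's format (`exists_simple_degenerate_of_model_balanced`: `2·#{x ∈ D : xg ∈ T₀} = |D|` for
all `g`, and `c` moves a point of `D` off `D`).  MECHANISM (observed, all instances found): the flips of the standard half sit in the
rows `t ∈ {0, 2}` only, i.e. on `1` and the element `a^2` of order `4` — the `Q₈ × C_p` norm-pair identity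
`A(β)² + B(β)² ≡ 0` transported along `Q₈ ↪ Q_{16}`-rows (see the seat notes, gen 39).

References: Shimura (1998), §6.2 Thm. 3, §8.2 Prop. 26 [cite: Shimura1998]; Gordon (1999), Thm. 6.4, §9.3
[cite: Gordon1999HodgeAVSurvey].
-/

noncomputable section

open CategoryTheory CategoryTheory.Limits NumberField
open scoped BigOperators

namespace Summit.HodgeConjecture.CorCM.GaloisModels

open Literature.NumberTheory.ComplexMultiplication
open Literature.AlgebraicGeometry.Motives (AbelianVariety CMType)
open Literature.AlgebraicGeometry.HodgeTheory
open Literature.AlgebraicGeometry.ComplexMultiplication (IsCMTypeRealisation)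
open Literature.AlgebraicGeometry.Pohlmann1968
open Literature.Barriers.HodgeConjecture (divisorClassesSpan)
open QuaternionGroup

variable {K : Type} [Field K] [NumberField K] [IsCMField K] [IsGalois ℚ K]

set_option maxRecDepth 16000 in
/-- The central elements of order `≤ 2` of `Q₁₆ × C₅` are `1` and `(a^4, 1)`. [folklore] -/
theorem central_involution_quaternionSixteen_cyclicFive :
    ∀ x : QuaternionGroup 4 × Multiplicative (ZMod 5), x * x = 1 → (∀ y, x * y = y * x) →
      x = 1 ∨ x = (a 4, Multiplicative.ofAdd 0) := by
  decide

set_option maxRecDepth 16000 in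
/-- **`Gal(K/ℚ) ≅ Q₁₆ × C₅` with complex conjugation `(a^4, 1)`: a simple DEGENERATE abelian `40`-fold with CM by `K`** (balanced set
of `6` elements moved by `c`), with a rational `(p,p)` class outside the divisor ring on some power.
[cite: Shimura1998, §6.2 Thm. 3 and §8.2 Prop. 26] [cite: Gordon1999HodgeAVSurvey, Thm. 6.4] -/
theorem exists_simple_degenerate_of_quaternionSixteen_cyclicFive
    (e : (K ≃ₐ[ℚ] K) ≃* QuaternionGroup 4 × Multiplicative (ZMod 5))
    (hc : e ((IsCMField.complexConj K).restrictScalars ℚ) = (a 4, Multiplicative.ofAdd 0)) :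
    ∃ (Φ : CMType K) (φ₀ : K →+* ℂ) (A : AbelianVariety ℂ) (ι : 𝓞 K →+* End A)
      (θ : K →+* Module.End ℂ (complexBetti A.X 1)),
      IsPrimitive (ℂ ≃+* ℂ) Φ.1 φ₀ ∧ ¬ IsNondegenerate Φ ∧ IsCMTypeRealisation Φ A ι θ ∧ A.IsSimple ∧
      A.dim = 40 ∧
      ∃ n p : ℕ, ∃ x : complexBetti (⨁ fun _ : Fin n => A).X (2 * p), IsRationalClass x ∧
        IsOfHodgeType (⨁ fun _ : Fin n => A).dim (⨁ fun _ : Fin n => A).X (2 * p) p p x ∧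
        x ∉ divisorClassesSpan (⨁ fun _ : Fin n => A).X (⨁ fun _ : Fin n => A).dim p := by
  have h := exists_simple_degenerate_of_model_balanced e _ hc
    {(a 0, Multiplicative.ofAdd 0), (a 0, Multiplicative.ofAdd 2), (a 0, Multiplicative.ofAdd 4),
      (a 1, Multiplicative.ofAdd 0), (a 1, Multiplicative.ofAdd 1), (a 1, Multiplicative.ofAdd 2),
      (a 1, Multiplicative.ofAdd 3), (a 1, Multiplicative.ofAdd 4), (a 2, Multiplicative.ofAdd 1),
      (a 2, Multiplicative.ofAdd 2), (a 2, Multiplicative.ofAdd 4), (a 3, Multiplicative.ofAdd 0),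
      (a 3, Multiplicative.ofAdd 1), (a 3, Multiplicative.ofAdd 2), (a 3, Multiplicative.ofAdd 3),
      (a 3, Multiplicative.ofAdd 4), (a 4, Multiplicative.ofAdd 1), (a 4, Multiplicative.ofAdd 3),
      (a 6, Multiplicative.ofAdd 0), (a 6, Multiplicative.ofAdd 3), (xa 0, Multiplicative.ofAdd 0),
      (xa 0, Multiplicative.ofAdd 2), (xa 0, Multiplicative.ofAdd 3), (xa 0, Multiplicative.ofAdd 4),
      (xa 1, Multiplicative.ofAdd 0), (xa 1, Multiplicative.ofAdd 1), (xa 1, Multiplicative.ofAdd 2),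
      (xa 1, Multiplicative.ofAdd 3), (xa 1, Multiplicative.ofAdd 4), (xa 2, Multiplicative.ofAdd 1),
      (xa 2, Multiplicative.ofAdd 2), (xa 2, Multiplicative.ofAdd 3), (xa 2, Multiplicative.ofAdd 4),
      (xa 3, Multiplicative.ofAdd 0), (xa 3, Multiplicative.ofAdd 1), (xa 3, Multiplicative.ofAdd 2),
      (xa 3, Multiplicative.ofAdd 3), (xa 3, Multiplicative.ofAdd 4), (xa 4, Multiplicative.ofAdd 1),
      (xa 6, Multiplicative.ofAdd 0)}
    (by decide) (by decide)
    {(a 0, Multiplicative.ofAdd 4), (a 2, Multiplicative.ofAdd 2), (a 2, Multiplicative.ofAdd 4),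
      (a 4, Multiplicative.ofAdd 2), (a 6, Multiplicative.ofAdd 0), (a 6, Multiplicative.ofAdd 1),
      (xa 0, Multiplicative.ofAdd 1), (xa 4, Multiplicative.ofAdd 0)}
    (by decide) (by decide)
  rwa [Fintype.card_prod, QuaternionGroup.card, Fintype.card_multiplicative, ZMod.card] at h

/-- **`Gal(K/ℚ) ≅ Q₁₆ × C₅` is BAD for the (unique) complex conjugation.** [cite: Shimura1998, §6.2 Thm. 3 and §8.2 Prop. 26]
[cite: Gordon1999HodgeAVSurvey, Thm. 6.4] -/
theorem exists_simple_degenerate_of_mulEquiv_quaternionSixteen_cyclicFive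
    (e : (K ≃ₐ[ℚ] K) ≃* QuaternionGroup 4 × Multiplicative (ZMod 5)) :
    ∃ (Φ : CMType K) (φ₀ : K →+* ℂ) (A : AbelianVariety ℂ) (ι : 𝓞 K →+* End A)
      (θ : K →+* Module.End ℂ (complexBetti A.X 1)),
      IsPrimitive (ℂ ≃+* ℂ) Φ.1 φ₀ ∧ ¬ IsNondegenerate Φ ∧ IsCMTypeRealisation Φ A ι θ ∧ A.IsSimple ∧
      A.dim = 40 ∧
      ∃ n p : ℕ, ∃ x : complexBetti (⨁ fun _ : Fin n => A).X (2 * p), IsRationalClass x ∧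
        IsOfHodgeType (⨁ fun _ : Fin n => A).dim (⨁ fun _ : Fin n => A).X (2 * p) p p x ∧
        x ∉ divisorClassesSpan (⨁ fun _ : Fin n => A).X (⨁ fun _ : Fin n => A).dim p := by
  set c₀ := e ((IsCMField.complexConj K).restrictScalars ℚ) with hc₀
  have hcc : c₀ * c₀ = 1 := GaloisRank.model_complexConj_mul_self e rfl
  have hz : ∀ y, c₀ * y = y * c₀ := fun y => GaloisRank.model_complexConj_comm e rfl y
  have hne : c₀ ≠ 1 := GaloisRank.model_complexConj_ne_one e rfl
  rcases central_involution_quaternionSixteen_cyclicFive c₀ hcc hz with h | h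
  · exact absurd h hne
  · exact exists_simple_degenerate_of_quaternionSixteen_cyclicFive e h

end Summit.HodgeConjecture.CorCM.GaloisModels

end
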